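import Summits.ResolutionOfSingularities.ResolutionOfSingularities.Theses.WeightedInvariant
import Summits.ResolutionOfSingularities.ResolutionOfSingularities.Theorems.WeightedInvariantWeightedConstructionACEquivalence

/-!
# Crux `WeightedConstruction` (stmt-ResolutionOfSingularities-0571) — line `support-first-weights-second`, lead c5 skeleton (v8)

Route `ResolutionOfSingularities/WeightedInvariant`. The crux is
`WeightedConstruction := ∀ p prime, Nonempty (WeightedResolutionDatum p)`.

STATE OF THE LINE (lead c5, 2026-08-17). Every infrastructure stub of the line has LANDED (leads gen-1 / c1:
`B₊(U)` regular, smooth, separated, quasi-compact for every affine chart; chart / basic-open localisation of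
vertices and strict transforms; closedness and smooth base change of the singular locus; the reductions
`ACChartPreDatum → PreDatum → WeightedResolutionDatum`, now unconditional in the tree:
`acChartPreDatum_toPreDatum`, `stub_preDatum_toDatum`). Against the TREE structures the line is therefore two
stubs: the bookkeeping `stub_acChartPreDatum_iff` (the transfer is EQUIVALENT to the crux — proved in
work/final/ACEquivalence.lean from landed reductions, lands with this registration) and the transfer
`stub_acChartPreDatum : ∀ p prime, Nonempty (ACChartPreDatum p)` — the characteristic-`p` construction with the
drop to be verified only over `k̄`, on weighted chart opens, at closed singular exceptional points (c1's
`TRANSFER-c1.md`: crux-sized; by `stub_acChartPreDatum_iff` it is the crux itself).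

STUBS (registered): `stub_acChartPreDatum_iff` (bookkeeping — LANDED p136232), `stub_acChartPreDatum` (TRANSFER, lead;
by the landed equivalence it is the crux itself: any proof of it is a proof of `WeightedConstruction` and conversely).
-/

noncomputable section

open CategoryTheory AlgebraicGeometry TopologicalSpace
open Literature.AlgebraicGeometry.Resolution
open Summit.ResolutionOfSingularities.ResolutionOfSingularities.Theses.WeightedInvariant

set_option linter.dupNamespace false -- mandated namespace of this single-conjunct summit

namespace Summit.ResolutionOfSingularities.ResolutionOfSingularities.Theorems

/-! ## Stubs -/

-- `stub_acChartPreDatum_iff` (bookkeeping: the transfer ≡ the crux) LANDED p136232 as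
-- Theorems/WeightedInvariantWeightedConstructionACEquivalence.lean (imported above).
example : ∀ p : ℕ, Nonempty (ACChartPreDatum p) ↔ Nonempty (WeightedResolutionDatum p) :=
  stub_acChartPreDatum_iff

/-- STUB `stub_acChartPreDatum` (TRANSFER, lead): for every prime `p` there is an algebraically-closed chart
pre-datum in characteristic `p` — ONE well-order `Γ`, a usc smooth-functorial base-change-invariant rating of
all pairs with `(ii)`, a functorial regular weighted centre on its maximum locus, and the drop of the rating at
every closed singular exceptional point of every weighted chart `B₊(U)` over an algebraically closed field
(Abramovich–Temkin–Włodarczyk 2024 §1.9; Włodarczyk arXiv:2203.03090 Thm. 4.3.1 supplies it in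
characteristic 0). -/
theorem stub_acChartPreDatum : ∀ p : ℕ, p.Prime → Nonempty (ACChartPreDatum p) := by
  sorry

/-! ## Composition (sorry-free): transfer ⇒ crux -/

/-- **The line closes the crux modulo its stubs.** -/
theorem WeightedConstruction_of
    (hI : ∀ p : ℕ, Nonempty (ACChartPreDatum p) ↔ Nonempty (WeightedResolutionDatum p))
    (hT : ∀ p : ℕ, p.Prime → Nonempty (ACChartPreDatum p)) : WeightedConstruction :=
  fun p hp => (hI p).mp (hT p hp)

/-- The crux, from the stubs. -/
theorem WeightedConstruction_holds_of_stubs : WeightedConstruction :=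
  WeightedConstruction_of stub_acChartPreDatum_iff stub_acChartPreDatum

end Summit.ResolutionOfSingularities.ResolutionOfSingularities.Theorems

end
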